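import Mathlib
import HarnessLib
import Summits.ValiantsHypothesis.ValiantsHypothesis.Theorems.LacunarySymmetroidMatrixDescartesProductPlusOneThetaShell

/-!
# LINE (A) `product_plus_one` (crux `MatrixDescartes`, stmt-ValiantsHypothesis-18050, V1) — W-CB, brick E1 of the ORDER-6 ADDITIVE CERTIFICATE
# `L₃ = (θ² − r₁²)(θ² − r₂²)(θ² − r₃²)`: the BINOMIAL TOWER CLOSES in `ψ₁`, and the sixth-order images of poles / slow knees / fast knees are ONE-SIGNED

Memo `pub/val-lit/lmr/NOTE-p7g18-18050-LINEA-sixth-order-certificate.md` (val-lit-p7 g18, rev 2; crit-1 g6 #235 PASS, exact algebra re-derived; pen val-idea-25 g5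
BY-NAME 08:09:58Z «E1 = YES»).  `K = 3`, support rates `p = d1 − d0`, `s = d2 − d1`, `q = p + s = d2 − d0`; tower of ✓ `…CloudDefs` (`rowPsi1/2/3 e₁ e₂ A B C x`,
normal form `A − Bx^{e₁+1} − Cx^{e₁+e₂+2}`).

§1 THE BINOMIAL TOWER CLOSES IN `ψ₁` (pure identities, one per pair; together with ✓ `pair01/pair12/pair02_rowPsi3_law` «ψ₃ = r²ψ₁ + 6ψ₁²»):
  `pair01_rowPsi2_sq`, `pair02_rowPsi2_sq`, `pair12_rowPsi2_sq`:  **ψ₂² = r²ψ₁² + 4ψ₁³**  (r = the pair's rate; knees AND poles).  Consequently every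
  θ-derivative of a polynomial in ψ₁ is a polynomial in ψ₁: `θ²(ψ₁^k) = k²r²ψ₁^k + 2k(2k+1)ψ₁^{k+1}`, and for ANY λ₁, λ₂, λ₃ (e₁ := Σλᵢ², e₂ := Σλᵢ²λⱼ²)
  `∏ᵢ(θ² − λᵢ²) ψ₁ = ∏ᵢ(r² − λᵢ²)·ψ₁ + 6(21r⁴ − 5e₁r² + e₂)·ψ₁² + 120(14r² − e₁)·ψ₁³ + 5040·ψ₁⁴` — the calculus half of this sentence (HasDerivAt chains)
  is NOT in this file (brick E2); here only the algebra it rests on.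
§2 THE SIXTH-ORDER COEFFICIENTS at {λᵢ} = {p, s, p+s} (real rates `0 < p ≤ s`, stated for real `p s`): with `e₁ = p² + s² + (p+s)²`,
  `e₂ = p²s² + p²(p+s)² + s²(p+s)²` the linear coefficient vanishes at r ∈ {p, s, p+s} and (pure `ring` factorisations)
  `c₀(p) = 6(s−p)(s−2p)(s+2p)(s+3p)`, `c₁(p) = −240(s+3p)(s−2p)`;  `c₀(s) = 6(s−p)(2s−p)(2s+p)(3s+p)`, `c₁(s) = 240(3s+p)(2s−p)`;
  `c₀(p+s) = 6(12p⁴ + 56p³s + 89p²s² + 56ps³ + 12s⁴)`, `c₁(p+s) = 120(12p² + 26ps + 12s²)`;  `c₂ = 5040`.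
§3 THE SIGN THEOREMS (the row images of `L₃Φ`, `Φ = −Σψ₁`, are `−Q_r(ψ₁)`, `Q_r(ψ) = c₀(r)ψ² + c₁(r)ψ³ + 5040ψ⁴`; poles have `ψ₁ > 0`, knees `ψ₁ < 0`):
  * `sixthOrder_pole_mid_pos`, `sixthOrder_pole_fast_pos` — poles of rate `s` or `p+s`: `Q > 0` on `ψ > 0` for every support with `p ≤ s` (all coefficients ≥ 0);
  * `sixthOrder_slowQuad_nonneg` — for `2p ≤ s` the quadratic `c₀(p) + c₁(p)ψ + 5040ψ²` is ≥ 0 for EVERY real ψ (discriminant: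
    `4·5040·c₀ − c₁² ∝ (s+3p)(s−2p)(22s² + 22ps + 36p²) ≥ 0`), hence `sixthOrder_pole_slow_nonneg` / `sixthOrder_pole_slow_pos` (slow pole: `Q ≥ 0`, and `Q > 0` off `ψ = 0`) and
    `sixthOrder_knee_slow_pos` (slow knee: `Q > 0` on `ψ < 0` — slow knees join the background under `L₃`);
  * `sixthOrder_knee_fast_coeffs_pos` — knees of rate `s` (`p < s`) or `p+s`: `c₀, c₁ > 0`, so `Q(ψ) < 0` exactly on the RING `c₀ + c₁ψ + 5040ψ² < 0`
    between two negative roots (`sixthOrder_ring_iff`) — the only places where a row image of `L₃Φ` is positive.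
So on supports with `d2 − d1 ≥ 2(d1 − d0)` (ratio `(d2−d0)/(d1−d0) ≥ 3`; the floor's open core is ratio > 4) EVERY pole and EVERY slow knee contributes a
nonpositive term to `L₃Φ` and every fast knee a term positive only on its ring (memo §2 (P)(SK)(FK); located consequences memo §4/§6).

HONEST FRAMING: algebra only (identities + polynomial sign facts); the order-6 Rolle shell, the localisation cell and the (RING) lemma are NOT here and NOT
proved anywhere yet; nothing here proves `WronskianBudgetK3` (EB2-W), `OneChangeFloorK3`, the stubs, `MatrixDescartes` (18050) or Conjecture B; `VP ≠ VNP` is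
NOT proved.  No definitions, no named facts, no sorry; Mathlib + ✓ `…ThetaShell` (tower) only.
-/

set_option linter.dupNamespace false

namespace Summit.ValiantsHypothesis.ValiantsHypothesis.Theorems.LacunarySymmetroidMatrixDescartes

namespace ProductPlusOne

open Finset Set
open scoped BigOperators

/-! ### §1 The binomial tower closes in `ψ₁`: `ψ₂² = r²ψ₁² + 4ψ₁³` -/

section Row

variable (e₁ e₂ : ℕ) (A B C : ℝ)

/-- Pair `(d0,d1)` (`C = 0`, rate `p = e₁+1`): **`ψ₂² = p²ψ₁² + 4ψ₁³`** (pure identity in the tower, knees and poles alike). [this file's lemma] -/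
theorem pair01_rowPsi2_sq (x : ℝ) :
    rowPsi2 e₁ e₂ A B 0 x ^ 2 = ((e₁ : ℝ) + 1) ^ 2 * rowPsi1 e₁ e₂ A B 0 x ^ 2 + 4 * rowPsi1 e₁ e₂ A B 0 x ^ 3 := by
  unfold rowPsi2 rowPsi1 rowH
  ring

/-- Pair `(d0,d2)` (`B = 0`, rate `q = e₁+e₂+2`): **`ψ₂² = q²ψ₁² + 4ψ₁³`**. [this file's lemma] -/
theorem pair02_rowPsi2_sq (x : ℝ) :
    rowPsi2 e₁ e₂ A 0 C x ^ 2 = ((e₁ : ℝ) + e₂ + 2) ^ 2 * rowPsi1 e₁ e₂ A 0 C x ^ 2 + 4 * rowPsi1 e₁ e₂ A 0 C x ^ 3 := by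
  unfold rowPsi2 rowPsi1 rowH
  ring

/-- Pair `(d1,d2)` (`A = 0`, rate `q − p = e₂+1`; uses `u·(−Bx^p − Cx^q) = 1`): **`ψ₂² = (q−p)²ψ₁² + 4ψ₁³`**. [this file's lemma] -/
theorem pair12_rowPsi2_sq {x : ℝ} (hF : (0 : ℝ) - B * x ^ (e₁ + 1) - C * x ^ (e₁ + e₂ + 2) ≠ 0) :
    rowPsi2 e₁ e₂ 0 B C x ^ 2 = ((e₂ : ℝ) + 1) ^ 2 * rowPsi1 e₁ e₂ 0 B C x ^ 2 + 4 * rowPsi1 e₁ e₂ 0 B C x ^ 3 := by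
  unfold rowPsi2 rowPsi1 rowH rowU
  field_simp
  ring

end Row


/-! ### §1b The ladder, as algebra: second θ-derivatives of `ψ₁²`, `ψ₁³` in terms of `ψ₁` -/

/-- **Ladder step for `ψ₁²`**: from the closure laws, `2ψ₂² + 2ψ₁ψ₃ = 4r²ψ₁² + 20ψ₁³` (this is `θ²(ψ₁²)` once `θψ₁ = ψ₂`, `θψ₂ = ψ₃`). [this file's lemma] -/
theorem ladder_sq {ψ₁ ψ₂ ψ₃ r : ℝ} (h2 : ψ₂ ^ 2 = r ^ 2 * ψ₁ ^ 2 + 4 * ψ₁ ^ 3) (h3 : ψ₃ = r ^ 2 * ψ₁ + 6 * ψ₁ ^ 2) :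
    2 * ψ₂ ^ 2 + 2 * ψ₁ * ψ₃ = 4 * r ^ 2 * ψ₁ ^ 2 + 20 * ψ₁ ^ 3 := by
  rw [h2, h3]; ring

/-- **Ladder step for `ψ₁³`**: `6ψ₁ψ₂² + 3ψ₁²ψ₃ = 9r²ψ₁³ + 42ψ₁⁴` (= `θ²(ψ₁³)`). [this file's lemma] -/
theorem ladder_cube {ψ₁ ψ₂ ψ₃ r : ℝ} (h2 : ψ₂ ^ 2 = r ^ 2 * ψ₁ ^ 2 + 4 * ψ₁ ^ 3) (h3 : ψ₃ = r ^ 2 * ψ₁ + 6 * ψ₁ ^ 2) :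
    6 * ψ₁ * ψ₂ ^ 2 + 3 * ψ₁ ^ 2 * ψ₃ = 9 * r ^ 2 * ψ₁ ^ 3 + 42 * ψ₁ ^ 4 := by
  rw [h2, h3]; ring

/-- **The three (θ² − λ²) iterates of `ψ₁`, as algebra.**  With `S₀ = ψ₁`, `S₁ := (r² − a)ψ₁ + 6ψ₁²` (= (θ² − a)ψ₁ by ✓ `pairXX_rowPsi3_law`),
`S₂ := (r² − a)(r² − b)ψ₁ + 6(5r² − a − b)ψ₁² + 120ψ₁³` and `S₃ := (r²−a)(r²−b)(r²−c)ψ₁ + 6(21r⁴ − 5(a+b+c)r² + (ab+ac+bc))ψ₁² + 120(14r² − (a+b+c))ψ₁³ + 5040ψ₁⁴`,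
the ladder gives `θ²S₁ − b·S₁ = S₂` and `θ²S₂ − c·S₂ = S₃`; here the two identities with `θ²(ψ₁^k)` replaced by its ladder value. [this file's lemma] -/
theorem sixthOrder_iterates_alg (ψ₁ r a b c : ℝ) :
    ((r ^ 2 - a) * (r ^ 2 * ψ₁ + 6 * ψ₁ ^ 2) + 6 * (4 * r ^ 2 * ψ₁ ^ 2 + 20 * ψ₁ ^ 3))
        - b * ((r ^ 2 - a) * ψ₁ + 6 * ψ₁ ^ 2)
      = (r ^ 2 - a) * (r ^ 2 - b) * ψ₁ + 6 * (5 * r ^ 2 - a - b) * ψ₁ ^ 2 + 120 * ψ₁ ^ 3 ∧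
    ((r ^ 2 - a) * (r ^ 2 - b) * (r ^ 2 * ψ₁ + 6 * ψ₁ ^ 2) + 6 * (5 * r ^ 2 - a - b) * (4 * r ^ 2 * ψ₁ ^ 2 + 20 * ψ₁ ^ 3)
          + 120 * (9 * r ^ 2 * ψ₁ ^ 3 + 42 * ψ₁ ^ 4))
        - c * ((r ^ 2 - a) * (r ^ 2 - b) * ψ₁ + 6 * (5 * r ^ 2 - a - b) * ψ₁ ^ 2 + 120 * ψ₁ ^ 3)
      = (r ^ 2 - a) * (r ^ 2 - b) * (r ^ 2 - c) * ψ₁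
        + 6 * (21 * r ^ 4 - 5 * (a + b + c) * r ^ 2 + (a * b + a * c + b * c)) * ψ₁ ^ 2
        + 120 * (14 * r ^ 2 - (a + b + c)) * ψ₁ ^ 3 + 5040 * ψ₁ ^ 4 := by
  constructor <;> ring

/-! ### §2 The sixth-order coefficients at the three rates `p`, `s`, `p + s` -/

section Coeffs

variable (p s : ℝ)

/-- The linear coefficient `∏ᵢ(r² − λᵢ²)` of `∏ᵢ(θ² − λᵢ²)ψ₁` VANISHES when `{λᵢ} = {p, s, p+s}` and `r` is one of them. [this file's lemma] -/
theorem sixthOrder_lin_vanish (r : ℝ) (hr : r = p ∨ r = s ∨ r = p + s) :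
    (r ^ 2 - p ^ 2) * (r ^ 2 - s ^ 2) * (r ^ 2 - (p + s) ^ 2) = 0 := by
  rcases hr with h | h | h <;> subst h <;> ring

/-- `c₀(p) = 6(21p⁴ − 5e₁p² + e₂) = 6(s−p)(s−2p)(s+2p)(s+3p)` (slow rate). [this file's lemma] -/
theorem sixthOrder_c0_slow :
    6 * (21 * p ^ 4 - 5 * (p ^ 2 + s ^ 2 + (p + s) ^ 2) * p ^ 2 + (p ^ 2 * s ^ 2 + p ^ 2 * (p + s) ^ 2 + s ^ 2 * (p + s) ^ 2))
      = 6 * ((s - p) * (s - 2 * p) * (s + 2 * p) * (s + 3 * p)) := by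
  ring

/-- `c₁(p) = 120(14p² − e₁) = −240(s+3p)(s−2p)` (slow rate). [this file's lemma] -/
theorem sixthOrder_c1_slow :
    120 * (14 * p ^ 2 - (p ^ 2 + s ^ 2 + (p + s) ^ 2)) = -(240 * ((s + 3 * p) * (s - 2 * p))) := by
  ring

/-- `c₀(s) = 6(s−p)(2s−p)(2s+p)(3s+p)` (middle rate). [this file's lemma] -/
theorem sixthOrder_c0_mid :
    6 * (21 * s ^ 4 - 5 * (p ^ 2 + s ^ 2 + (p + s) ^ 2) * s ^ 2 + (p ^ 2 * s ^ 2 + p ^ 2 * (p + s) ^ 2 + s ^ 2 * (p + s) ^ 2))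
      = 6 * ((s - p) * (2 * s - p) * (2 * s + p) * (3 * s + p)) := by
  ring

/-- `c₁(s) = 240(3s+p)(2s−p)` (middle rate). [this file's lemma] -/
theorem sixthOrder_c1_mid :
    120 * (14 * s ^ 2 - (p ^ 2 + s ^ 2 + (p + s) ^ 2)) = 240 * ((3 * s + p) * (2 * s - p)) := by
  ring

/-- `c₀(p+s) = 6(12p⁴ + 56p³s + 89p²s² + 56ps³ + 12s⁴)` (fast rate). [this file's lemma] -/
theorem sixthOrder_c0_fast :
    6 * (21 * (p + s) ^ 4 - 5 * (p ^ 2 + s ^ 2 + (p + s) ^ 2) * (p + s) ^ 2 + (p ^ 2 * s ^ 2 + p ^ 2 * (p + s) ^ 2 + s ^ 2 * (p + s) ^ 2))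
      = 6 * (12 * p ^ 4 + 56 * p ^ 3 * s + 89 * p ^ 2 * s ^ 2 + 56 * p * s ^ 3 + 12 * s ^ 4) := by
  ring

/-- `c₁(p+s) = 120(12p² + 26ps + 12s²)` (fast rate). [this file's lemma] -/
theorem sixthOrder_c1_fast :
    120 * (14 * (p + s) ^ 2 - (p ^ 2 + s ^ 2 + (p + s) ^ 2)) = 120 * (12 * p ^ 2 + 26 * p * s + 12 * s ^ 2) := by
  ring

end Coeffs

/-! ### §3 The sign theorems -/

section Signs

variable {p s : ℝ}

/-- **Pole of the middle rate `s`** (`0 < p ≤ s`), image coefficients `c₀(s), c₁(s) ≥ 0`, `c₂ = 5040 > 0`: `Q_s(ψ) > 0` for `ψ > 0`. [this file's theorem] -/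
theorem sixthOrder_pole_mid_pos (hp : 0 < p) (hps : p ≤ s) {ψ : ℝ} (hψ : 0 < ψ) :
    0 < 6 * ((s - p) * (2 * s - p) * (2 * s + p) * (3 * s + p)) * ψ ^ 2 + 240 * ((3 * s + p) * (2 * s - p)) * ψ ^ 3 + 5040 * ψ ^ 4 := by
  have ha : 0 ≤ s - p := by linarith
  have hb : 0 ≤ 2 * s - p := by linarith
  have hc : 0 ≤ 2 * s + p := by linarith
  have hd : 0 ≤ 3 * s + p := by linarith
  have h1 : 0 ≤ 6 * ((s - p) * (2 * s - p) * (2 * s + p) * (3 * s + p)) * ψ ^ 2 :=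
    mul_nonneg (mul_nonneg (by norm_num) (mul_nonneg (mul_nonneg (mul_nonneg ha hb) hc) hd)) (sq_nonneg ψ)
  have h2 : 0 ≤ 240 * ((3 * s + p) * (2 * s - p)) * ψ ^ 3 :=
    mul_nonneg (mul_nonneg (by norm_num) (mul_nonneg hd hb)) (pow_nonneg hψ.le 3)
  have h3 : 0 < 5040 * ψ ^ 4 := by positivity
  linarith

/-- **Pole of the fast rate `p + s`** (`0 < p`, `0 < s`): `Q_{p+s}(ψ) > 0` for `ψ > 0`. [this file's theorem] -/
theorem sixthOrder_pole_fast_pos (hp : 0 < p) (hs : 0 < s) {ψ : ℝ} (hψ : 0 < ψ) :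
    0 < 6 * (12 * p ^ 4 + 56 * p ^ 3 * s + 89 * p ^ 2 * s ^ 2 + 56 * p * s ^ 3 + 12 * s ^ 4) * ψ ^ 2
      + 120 * (12 * p ^ 2 + 26 * p * s + 12 * s ^ 2) * ψ ^ 3 + 5040 * ψ ^ 4 := by
  positivity

/-- **The slow quadratic is positive semidefinite** (`0 < p`, `2p ≤ s`): `c₀(p) + c₁(p)·ψ + 5040·ψ² ≥ 0` for EVERY real `ψ` (discriminant
`4·5040·c₀(p) − c₁(p)² = 5760(s+3p)(s−2p)·(11s² + 11ps + 18p²)·… ≥ 0`, written as a sum of squares). [this file's theorem] -/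
theorem sixthOrder_slowQuad_nonneg (hp : 0 < p) (h2 : 2 * p ≤ s) (ψ : ℝ) :
    0 ≤ 6 * ((s - p) * (s - 2 * p) * (s + 2 * p) * (s + 3 * p)) + (-(240 * ((s + 3 * p) * (s - 2 * p)))) * ψ + 5040 * ψ ^ 2 := by
  have hs2 : 0 ≤ s - 2 * p := by linarith
  have hs3 : 0 < s + 3 * p := by linarith
  have hs1 : 0 < s - p := by linarith
  -- complete the square: 5040ψ² − 240(s+3p)(s−2p)ψ + 6(s−p)(s−2p)(s+2p)(s+3p)
  --   = 5040(ψ − (s+3p)(s−2p)/42)² + (s+3p)(s−2p)[6(s−p)(s+2p) − (240²/(4·5040))(s+3p)(s−2p)]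
  -- and 6(s−p)(s+2p) − (20/7)(s+3p)(s−2p) = (22s² + 22ps + 36p²)/7 ≥ 0
  have hs : 0 < s := by linarith
  have hq : (0:ℝ) ≤ 22 * s ^ 2 + 22 * p * s + 36 * p ^ 2 := by positivity
  nlinarith [sq_nonneg (ψ - (s + 3 * p) * (s - 2 * p) / 42), mul_nonneg hs3.le hs2,
    mul_nonneg (mul_nonneg hs3.le hs2) hq]

/-- **Pole of the slow rate `p`** (`0 < p`, `2p ≤ s`): `Q_p(ψ) ≥ 0` for every real `ψ` (in particular on `ψ > 0`). [this file's theorem] -/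
theorem sixthOrder_pole_slow_nonneg (hp : 0 < p) (h2 : 2 * p ≤ s) (ψ : ℝ) :
    0 ≤ 6 * ((s - p) * (s - 2 * p) * (s + 2 * p) * (s + 3 * p)) * ψ ^ 2 + (-(240 * ((s + 3 * p) * (s - 2 * p)))) * ψ ^ 3 + 5040 * ψ ^ 4 := by
  have h := sixthOrder_slowQuad_nonneg hp h2 ψ
  have hψ2 : 0 ≤ ψ ^ 2 := sq_nonneg ψ
  have : 6 * ((s - p) * (s - 2 * p) * (s + 2 * p) * (s + 3 * p)) * ψ ^ 2 + (-(240 * ((s + 3 * p) * (s - 2 * p)))) * ψ ^ 3 + 5040 * ψ ^ 4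
      = ψ ^ 2 * (6 * ((s - p) * (s - 2 * p) * (s + 2 * p) * (s + 3 * p)) + (-(240 * ((s + 3 * p) * (s - 2 * p)))) * ψ + 5040 * ψ ^ 2) := by ring
  rw [this]
  exact mul_nonneg hψ2 h


/-- **Pole of the slow rate `p`, strict** (`0 < p`, `2p ≤ s`, `ψ ≠ 0`): `Q_p(ψ) > 0` (if `s = 2p` then `c₀ = c₁ = 0` and `Q = 5040ψ⁴`; if `s > 2p` the
quadratic is positive definite). [this file's theorem] -/
theorem sixthOrder_pole_slow_pos (hp : 0 < p) (h2 : 2 * p ≤ s) {ψ : ℝ} (hψ : ψ ≠ 0) :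
    0 < 6 * ((s - p) * (s - 2 * p) * (s + 2 * p) * (s + 3 * p)) * ψ ^ 2 + (-(240 * ((s + 3 * p) * (s - 2 * p)))) * ψ ^ 3 + 5040 * ψ ^ 4 := by
  have hψ2 : 0 < ψ ^ 2 := by positivity
  have key : 0 < 6 * ((s - p) * (s - 2 * p) * (s + 2 * p) * (s + 3 * p)) + (-(240 * ((s + 3 * p) * (s - 2 * p)))) * ψ + 5040 * ψ ^ 2 := by
    rcases eq_or_lt_of_le h2 with h | h
    · -- s = 2p: c₀ = c₁ = 0
      have hs : s - 2 * p = 0 := by linarith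
      rw [hs]; simp only [mul_zero, zero_mul, neg_zero, zero_add]
      positivity
    · have hs2 : 0 < s - 2 * p := by linarith
      have hs3 : 0 < s + 3 * p := by linarith
      have hs : 0 < s := by linarith
      have hq : (0:ℝ) < 22 * s ^ 2 + 22 * p * s + 36 * p ^ 2 := by positivity
      nlinarith [sq_nonneg (ψ - (s + 3 * p) * (s - 2 * p) / 42), mul_pos hs3 hs2, mul_pos (mul_pos hs3 hs2) hq]
  have : 6 * ((s - p) * (s - 2 * p) * (s + 2 * p) * (s + 3 * p)) * ψ ^ 2 + (-(240 * ((s + 3 * p) * (s - 2 * p)))) * ψ ^ 3 + 5040 * ψ ^ 4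
      = ψ ^ 2 * (6 * ((s - p) * (s - 2 * p) * (s + 2 * p) * (s + 3 * p)) + (-(240 * ((s + 3 * p) * (s - 2 * p)))) * ψ + 5040 * ψ ^ 2) := by ring
  rw [this]
  exact mul_pos hψ2 key

/-- **Slow knee** (`0 < p`, `2p ≤ s`, `ψ < 0`): `Q_p(ψ) > 0` — under `L₃` a slow knee is a BACKGROUND term like a pole. [this file's theorem] -/
theorem sixthOrder_knee_slow_pos (hp : 0 < p) (h2 : 2 * p ≤ s) {ψ : ℝ} (hψ : ψ < 0) :
    0 < 6 * ((s - p) * (s - 2 * p) * (s + 2 * p) * (s + 3 * p)) * ψ ^ 2 + (-(240 * ((s + 3 * p) * (s - 2 * p)))) * ψ ^ 3 + 5040 * ψ ^ 4 := by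
  have hs2 : 0 ≤ s - 2 * p := by linarith
  have h1 : 0 ≤ 6 * ((s - p) * (s - 2 * p) * (s + 2 * p) * (s + 3 * p)) * ψ ^ 2 := by
    have h3 : 0 ≤ s - p := by linarith
    have h4 : 0 ≤ s + 2 * p := by linarith
    have h5 : 0 ≤ s + 3 * p := by linarith
    exact mul_nonneg (mul_nonneg (by norm_num) (mul_nonneg (mul_nonneg (mul_nonneg h3 hs2) h4) h5)) (sq_nonneg ψ)
  have h2' : 0 ≤ (-(240 * ((s + 3 * p) * (s - 2 * p)))) * ψ ^ 3 := by
    have h6 : 0 ≤ (s + 3 * p) * (s - 2 * p) := mul_nonneg (by linarith) hs2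
    have h7 : ψ ^ 3 ≤ 0 := by
      have : ψ ^ 3 = ψ * ψ ^ 2 := by ring
      rw [this]; exact mul_nonpos_of_nonpos_of_nonneg hψ.le (sq_nonneg ψ)
    nlinarith
  have h3 : 0 < 5040 * ψ ^ 4 := by
    have hψ0 : ψ ≠ 0 := hψ.ne
    have : 0 < ψ ^ 4 := by positivity
    linarith
  linarith

/-- **Fast knees have positive image coefficients**: for the middle rate `s` with `0 < p < s`, and for the fast rate `p + s` with `0 < p, s`,
`c₀ > 0` and `c₁ > 0` — so `Q(ψ) = ψ²(c₀ + c₁ψ + 5040ψ²)` is negative exactly on the ring `c₀ + c₁ψ + 5040ψ² < 0`. [this file's theorem] -/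
theorem sixthOrder_knee_fast_coeffs_pos (hp : 0 < p) (hs : 0 < s) (hps : p < s) :
    0 < 6 * ((s - p) * (2 * s - p) * (2 * s + p) * (3 * s + p)) ∧ 0 < 240 * ((3 * s + p) * (2 * s - p)) ∧
      0 < 6 * (12 * p ^ 4 + 56 * p ^ 3 * s + 89 * p ^ 2 * s ^ 2 + 56 * p * s ^ 3 + 12 * s ^ 4) ∧
      0 < 120 * (12 * p ^ 2 + 26 * p * s + 12 * s ^ 2) := by
  have h1 : 0 < s - p := by linarith
  have h2 : 0 < 2 * s - p := by linarith
  have h3 : 0 < 2 * s + p := by linarith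
  have h4 : 0 < 3 * s + p := by linarith
  refine ⟨mul_pos (by norm_num) (mul_pos (mul_pos (mul_pos h1 h2) h3) h4), mul_pos (by norm_num) (mul_pos h4 h2),
    by positivity, by positivity⟩

/-- **The ring of a fast knee**: for `ψ ≠ 0`, `ψ²(c₀ + c₁ψ + c₂ψ²) < 0 ↔ c₀ + c₁ψ + c₂ψ² < 0`. [folklore] -/
theorem sixthOrder_ring_iff (c₀ c₁ c₂ : ℝ) {ψ : ℝ} (hψ : ψ ≠ 0) :
    c₀ * ψ ^ 2 + c₁ * ψ ^ 3 + c₂ * ψ ^ 4 < 0 ↔ c₀ + c₁ * ψ + c₂ * ψ ^ 2 < 0 := by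
  have hψ2 : 0 < ψ ^ 2 := by positivity
  have : c₀ * ψ ^ 2 + c₁ * ψ ^ 3 + c₂ * ψ ^ 4 = ψ ^ 2 * (c₀ + c₁ * ψ + c₂ * ψ ^ 2) := by ring
  rw [this, mul_neg_iff]
  constructor
  · rintro (⟨-, h⟩ | ⟨h, -⟩)
    · exact h
    · exact absurd hψ2 (not_lt.2 h.le)
  · exact fun h => Or.inl ⟨hψ2, h⟩

/-- **A fast ring sits at negative `ψ` and is bounded**: if `c₀, c₁, c₂ > 0` then every `ψ` in the ring has `−c₁/c₂ < ψ < 0`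
(both roots of the quadratic are negative; the ring never reaches `ψ = 0`, i.e. the far tails of a fast knee are NOT in its ring). [this file's theorem] -/
theorem sixthOrder_ring_neg {c₀ c₁ c₂ ψ : ℝ} (h0 : 0 < c₀) (h1 : 0 < c₁) (h2 : 0 < c₂) (hring : c₀ + c₁ * ψ + c₂ * ψ ^ 2 < 0) :
    -(c₁ / c₂) < ψ ∧ ψ < 0 := by
  constructor
  · by_contra hle
    push Not at hle
    -- ψ ≤ −c₁/c₂ ⇒ c₂ψ² ≥ −c₁ψ ⇒ quadratic ≥ c₀ > 0
    have hψneg : ψ < 0 := by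
      have : -(c₁ / c₂) < 0 := by rw [neg_lt_zero]; exact div_pos h1 h2
      linarith
    have hprod : c₁ * ψ + c₂ * ψ ^ 2 ≥ 0 := by
      have : c₂ * ψ ≤ -c₁ := by
        have := mul_le_mul_of_nonneg_left hle h2.le
        rw [mul_neg, mul_div_cancel₀ _ h2.ne'] at this
        linarith
      nlinarith
    linarith
  · by_contra hge
    push Not at hge
    have : 0 ≤ c₁ * ψ + c₂ * ψ ^ 2 := by positivity
    linarith

end Signs

end ProductPlusOne

end Summit.ValiantsHypothesis.ValiantsHypothesis.Theorems.LacunarySymmetroidMatrixDescartes
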